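import Literature.NumberTheory.GelbartRogawski1991.Sec2
import HarnessLib

/-!
# Gelbart–Rogawski 1991, §2 (pp. 451–453): the pure-logic consequences of the §2 carpet, PROVED
# («`Λ(π)` is a union of `B(F)`-orbits», `R^∧ = ⊔_ψ R^∧(ψ)`, the one-dimensional constituents lie
# outside `R^∧`, Definition 2.3.1 (1)(2) ⇒ Theorem 2.4.1)

Sibling PROOF file of the statement carpet ★ `Literature/NumberTheory/GelbartRogawski1991/Sec2.lean`
(+ its datum ★ `Sec2Defs.lean`; squad TG, cell hodgecm-mathlib; squad ruling: K-consequences live in a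
sibling file so that carpets stay theorem-free — cf. ★ `Sec1Proofs.lean`, ★ `Sec6Proofs.lean`).  The
carpet records the printed assertions of [GelbartRogawski1991] §2 as `Prop`-valued predicates over the
posited datum `J : GR91RData X GA`; the handful of printed (or printed-and-presupposed) sentences that
follow from those predicates BY PURE LOGIC are proved here, each taking the ★ facts it needs as explicit
hypotheses `(h : Sec2.<fact> J)` — nothing is asserted, no fact is restated, no new notion is introduced:

* `lambda_bAct_mem` ∕ `sameOrbit_mem_lambda` — p. 452 L5 «The set `Λ(π)` is a union of `B(F)`-orbits»,
  from ★ `Sec2.bAct_rhat` («`b` maps `R^∧(ψ)` to `R^∧(ψ^{Nα})`») and ★ `Sec2.fjTau_bAct`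
  («`φ_{τb}(g) = φ_τ(bg)`») with the datum field `form_le_autForm` (`V_π ⊆` automorphic forms): if
  `φ_τ ≠ 0` then `φ_{τb} = φ_τ(b ·) ≠ 0`.  (This is the K-remark recorded in the docstring of ★
  `Sec2.fjTau_bAct`; typed as «`Λ(π)` contains the `B(F)`-orbit of each of its elements», which is what
  «union of orbits» means for the posited action `J.bAct` — no group-action axioms are posited or used.)
* `lambda_subset_rhat`, `rhatPsi_subset_rhat` — `Λ(π) ⊆ R^∧`, `R^∧(ψ) ⊆ R^∧` (unfolding of the ★ DEFs).
* `exc1_lambda_nonempty` — condition (1) of Definition 2.3.1 («`Λ(π)` is a single `B(F)`-orbit») gives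
  `Λ(π) ≠ ∅` (the orbit of `τ₀ ∈ Λ(π)`), the form in which §3 uses it («let `τ ∈ Λ(π)`»).
* `addChar_eq_of_uActsVia` ∕ `addChar_eq_of_mem_rhatPsi` ∕ `existsUnique_rhatPsi` ∕ `rhat_eq_iUnion_rhatPsi`
  — p. 451 §2.2–2.3: «Let `R^∧(ψ)` be the set of elements of `R^∧` on which `U(𝔸)` acts via `ψ`» and
  «(2.1.2) reads (2.3.1) `φ(g) = φ_U(g) + Σ_{τ ∈ R^∧} φ_τ(g)`» presuppose `R^∧ = ⊔_ψ R^∧(ψ)` (DISJOINT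
  union: the `ψ` of `τ ∈ R^∧(ψ)` is determined by `τ`, and every `τ ∈ R^∧` has one); proved from ★
  `Sec2.psiU_char` (distinct `ψ` stay distinct on `U(𝔸)`) and ★ `Sec2.rhat_exists_psi` (P-IMPLICIT step of
  the carpet), using only that an element of `R^∧` is infinite-dimensional, hence a non-zero subspace.
* `not_mem_rhat_of_uActsTriv` — §2.5 p. 453 L22–23 «The constitutents [sic] on which `U(𝔸)` acts trivially
  are one-dimensional» (★ `Sec2.sec25_oneDim`) ⇒ such constituents are NOT in `R^∧` (which consists of the
  infinite-dimensional ones, ★ DEF `RHat`), i.e. `U(𝔸)` acts non-trivially on every `τ ∈ R^∧` — the reading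
  of §2.2 under which «`R^∧(ψ)`, `ψ` non-trivial» exhausts `R^∧`.
* `mem_packetA_of_conditions` — Definition 2.3.1 typed as ★ `Sec2.def231` (★ `IsExceptional π ↔ (1) ∧ (2)`
  for discrete `π`) fed into ★ `GR91Spectrum.thm241` (Theorem 2.4.1, p. 452 «If `π` is exceptional, then
  `π` belongs to `Π(ϱ)` for some automorphic character `ϱ` of `H`»): a discrete `π` satisfying the two
  printed CONDITIONS lies in some `Π(ρ) = packetA η η′`.

THEOREMS ONLY (no definition, no named fact, no instance, no notation, no attribute, no `sorry`);
imports ★ `Sec2` only (which carries ★ `Sec2Defs`, ★ `WeilRepresentationsAPackets`).  Page∕line pins were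
read on the page images `img_p451.jpg`, `img_p452.jpg`, `img_p453.jpg` of the open GDZ digitisation
(PPN356556735_0105) used by the whole squad (see the module docstring of ★ `Sec2.lean`).

## References
* [GelbartRogawski1991] S. Gelbart, J. Rogawski, *L-functions and Fourier–Jacobi coefficients for the
  unitary group `U(3)`*, Invent. Math. 105 (1991) 445–472: §2.2–2.3 p. 451 L19–34, p. 452 L1–9,
  Theorem 2.4.1 p. 452, §2.5 p. 453 L22–23.
-/

namespace Literature.NumberTheory.GelbartRogawski1991.Sec2Proofs

open Literature.NumberTheory.GelbartRogawski1991.Sec2Defs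
open Literature.NumberTheory.GelbartRogawski1991.Sec2

universe u

variable {X : GR91Spectrum.{u}} {GA : Type u} [Group GA] (J : GR91RData X GA)

/-! ### `Λ(π) ⊆ R^∧`, `R^∧(ψ) ⊆ R^∧` (unfolding of the ★ definitions of §2.2–2.3, p. 451–452) -/

/-- `R^∧(ψ) ⊆ R^∧` («the set of elements of `R^∧` on which `U(𝔸)` acts via `ψ`»).
[cite: GelbartRogawski1991, §2.2 (p. 451 L24)] -/
theorem rhatPsi_subset_rhat (ψ : X.AddChar) : J.RHatPsi ψ ⊆ J.RHat :=
  fun _ hτ => hτ.1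

/-- `Λ(π) ⊆ R^∧` («`Λ(π) = {τ ∈ R^∧ : φ_τ ≠ 0` for some `φ ∈ V_π}`»).
[cite: GelbartRogawski1991, §2.3 (p. 452 L1–2)] -/
theorem lambda_subset_rhat (π : X.Rep) : J.Lambda π ⊆ J.RHat := by
  rintro τ ⟨ψ, hτψ, -⟩
  exact hτψ.1

/-! ### «The set `Λ(π)` is a union of `B(F)`-orbits» (p. 452 L5) -/

/-- **K (p. 452 L5)** «The set `Λ(π)` is a union of `B(F)`-orbits»: for `b ∈ B(F)` and `τ ∈ Λ(π)`,
`τb ∈ Λ(π)` — from ★ `Sec2.bAct_rhat` («`b` maps `R^∧(ψ)` to `R^∧(ψ^{Nα})`») and ★ `Sec2.fjTau_bAct`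
(«`φ_{τb}(g) = φ_τ(bg)`»): if `φ_τ(g₀) ≠ 0` then `φ_{τb}(b⁻¹g₀) = φ_τ(g₀) ≠ 0`.
[cite: GelbartRogawski1991, §2.3 (p. 452 L3–5)] -/
theorem lambda_bAct_mem (h₁ : bAct_rhat J) (h₂ : fjTau_bAct J) (π : X.Rep) (b : ↥(J.B ⊓ J.GF))
    {τ : Submodule ℂ (J.R → ℂ)} (hτ : τ ∈ J.Lambda π) : J.bAct b τ ∈ J.Lambda π := by
  obtain ⟨ψ, hτψ, φ, hφ, hne⟩ := hτ
  obtain ⟨ψ', -, hb⟩ := h₁ b ψ τ hτψ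
  refine ⟨ψ', hb, φ, hφ, ?_⟩
  intro h0
  apply hne
  funext g
  have key := h₂ b ψ ψ' τ hτψ hb φ (J.form_le_autForm π hφ) ((b : GA)⁻¹ * g)
  rw [h0, mul_inv_cancel_left] at key
  simpa using key.symm

/-- **K (p. 452 L5)**, orbit form: `Λ(π)` contains the `B(F)`-orbit (★ `SameOrbit`) of each of its
elements. [cite: GelbartRogawski1991, §2.3 (p. 452 L3–5)] -/
theorem sameOrbit_mem_lambda (h₁ : bAct_rhat J) (h₂ : fjTau_bAct J) (π : X.Rep)
    {τ τ' : Submodule ℂ (J.R → ℂ)} (hτ : τ ∈ J.Lambda π) (ho : J.SameOrbit τ τ') :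
    τ' ∈ J.Lambda π := by
  obtain ⟨b, rfl⟩ := ho
  exact lambda_bAct_mem J h₁ h₂ π b hτ

/-- **K (p. 452 L5)**, set form: for every `b ∈ B(F)`, the image of `Λ(π)` under `τ ↦ τb` lies in
`Λ(π)`. [cite: GelbartRogawski1991, §2.3 (p. 452 L3–5)] -/
theorem bAct_image_lambda_subset (h₁ : bAct_rhat J) (h₂ : fjTau_bAct J) (π : X.Rep)
    (b : ↥(J.B ⊓ J.GF)) : J.bAct b '' J.Lambda π ⊆ J.Lambda π := by
  rintro _ ⟨τ, hτ, rfl⟩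
  exact lambda_bAct_mem J h₁ h₂ π b hτ

/-! ### Definition 2.3.1 (1) gives `Λ(π) ≠ ∅` (p. 452 L6–8) -/

/-- Condition (1) of Definition 2.3.1 («`Λ(π)` is a single `B(F)`-orbit», ★ `Sec2.exc1`) gives
`Λ(π) ≠ ∅` — the orbit is that of some `τ₀ ∈ Λ(π)` (★ DEF `IsSingleBOrbit`); this is how §3 uses it
(«let `τ ∈ Λ(π)`»). [cite: GelbartRogawski1991, Def. 2.3.1 (1) (p. 452 L6–8)] -/
theorem exc1_lambda_nonempty (π : X.Rep) (h : exc1 J π) : (J.Lambda π).Nonempty := by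
  obtain ⟨τ₀, hτ₀, -⟩ := h
  exact ⟨τ₀, hτ₀⟩

/-- Under condition (1) of Definition 2.3.1, any two elements of `Λ(π)` are `B(F)`-translates of one
`τ₀ ∈ Λ(π)`. [cite: GelbartRogawski1991, Def. 2.3.1 (1) (p. 452 L6–8)] -/
theorem exc1_exists_base (π : X.Rep) (h : exc1 J π) :
    ∃ τ₀ ∈ J.Lambda π, ∀ τ ∈ J.Lambda π, J.SameOrbit τ₀ τ := by
  obtain ⟨τ₀, hτ₀, hS⟩ := h
  refine ⟨τ₀, hτ₀, fun τ hτ => ?_⟩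
  rw [hS] at hτ
  exact hτ

/-! ### `R^∧ = ⊔_ψ R^∧(ψ)` (p. 451 §2.2–2.3: the indexing «`τ ∈ R^∧`» of (2.3.1) by pairs `(ψ, τ ∈ R^∧(ψ))`) -/

/-- The character through which `U(𝔸)` acts on a NON-ZERO space of functions on `R(𝔸)` is unique:
from ★ `Sec2.psiU_char` (distinct `ψ` are distinct characters of `U(F)\U(𝔸)`); pick `f ∈ S` and `r`
with `f(r) ≠ 0` and cancel `f(r)` in `ψ(u) f(r) = f(r u) = ψ′(u) f(r)`.
[cite: GelbartRogawski1991, §2.1–2.2 (p. 451 L6–7, L24)] -/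
theorem addChar_eq_of_uActsVia (h : psiU_char J) {S : Submodule ℂ (J.R → ℂ)} (hS : S ≠ ⊥)
    {ψ ψ' : X.AddChar} (h₁ : J.UActsVia S ψ) (h₂ : J.UActsVia S ψ') : ψ = ψ' := by
  obtain ⟨f, hf, hf0⟩ := (Submodule.ne_bot_iff S).1 hS
  obtain ⟨r, hr⟩ := Function.ne_iff.1 hf0
  apply h.1
  funext u
  have e₁ := h₁ f hf u r
  have e₂ := h₂ f hf u r
  rw [e₁] at e₂
  exact mul_right_cancel₀ hr e₂

/-- An element of `R^∧` (infinite-dimensional, ★ DEF `RHat`) is a non-zero subspace.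
[cite: GelbartRogawski1991, §2.2 (p. 451 L19–20)] -/
theorem ne_bot_of_mem_rhat {τ : Submodule ℂ (J.R → ℂ)} (hτ : τ ∈ J.RHat) : τ ≠ ⊥ := by
  rintro rfl
  exact hτ.2 inferInstance

/-- The sets `R^∧(ψ)` are pairwise disjoint: the `ψ` with `τ ∈ R^∧(ψ)` is determined by `τ`
(from ★ `Sec2.psiU_char`). [cite: GelbartRogawski1991, §2.2 (p. 451 L24)] -/
theorem addChar_eq_of_mem_rhatPsi (h : psiU_char J) {τ : Submodule ℂ (J.R → ℂ)} {ψ ψ' : X.AddChar}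
    (h₁ : τ ∈ J.RHatPsi ψ) (h₂ : τ ∈ J.RHatPsi ψ') : ψ = ψ' :=
  addChar_eq_of_uActsVia J h (ne_bot_of_mem_rhat J h₁.1) h₁.2 h₂.2

/-- Disjointness of `R^∧(ψ)` and `R^∧(ψ′)` for `ψ ≠ ψ′`, as sets (from ★ `Sec2.psiU_char`).
[cite: GelbartRogawski1991, §2.2 (p. 451 L24)] -/
theorem rhatPsi_disjoint (h : psiU_char J) {ψ ψ' : X.AddChar} (hne : ψ ≠ ψ') :
    Disjoint (J.RHatPsi ψ) (J.RHatPsi ψ') := by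
  rw [Set.disjoint_left]
  intro τ h₁ h₂
  exact hne (addChar_eq_of_mem_rhatPsi J h h₁ h₂)

/-- `R^∧ = ⋃_ψ R^∧(ψ)`: every element of `R^∧` lies in some `R^∧(ψ)` (★ `Sec2.rhat_exists_psi`, the
P-IMPLICIT step «how (2.1.2) reads (2.3.1)») and conversely by definition.
[cite: GelbartRogawski1991, §2.2–2.3 (p. 451 L24, L31–34)] -/
theorem rhat_eq_iUnion_rhatPsi (h : rhat_exists_psi J) : J.RHat = ⋃ ψ : X.AddChar, J.RHatPsi ψ := by
  ext τ
  simp only [Set.mem_iUnion]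
  constructor
  · intro hτ
    obtain ⟨ψ, hψ⟩ := h τ hτ
    exact ⟨ψ, hτ, hψ⟩
  · rintro ⟨ψ, hψ⟩
    exact hψ.1

/-- `R^∧ = ⊔_ψ R^∧(ψ)` is a DISJOINT union: every `τ ∈ R^∧` lies in `R^∧(ψ)` for exactly one `ψ`
(★ `Sec2.rhat_exists_psi` for existence, ★ `Sec2.psiU_char` for uniqueness) — the indexing of the sum
«`Σ_{τ ∈ R^∧} φ_τ(g)`» in (2.3.1) by the pairs `(ψ, τ ∈ R^∧(ψ))` used in ★ `Sec2.eq231`.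
[cite: GelbartRogawski1991, §2.3 (2.3.1) (p. 451 L31–34)] -/
theorem existsUnique_rhatPsi (hψ : psiU_char J) (hex : rhat_exists_psi J)
    {τ : Submodule ℂ (J.R → ℂ)} (hτ : τ ∈ J.RHat) : ∃! ψ : X.AddChar, τ ∈ J.RHatPsi ψ := by
  obtain ⟨ψ, hψτ⟩ := hex τ hτ
  exact ⟨ψ, ⟨hτ, hψτ⟩, fun ψ' h' => addChar_eq_of_mem_rhatPsi J hψ h' ⟨hτ, hψτ⟩⟩

/-! ### The one-dimensional constituents lie outside `R^∧` (§2.5 p. 453 L22–23 with §2.2 p. 451 L19–20) -/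

/-- «The constitutents [sic] on which `U(𝔸)` acts trivially are one-dimensional» (★ `Sec2.sec25_oneDim`)
⇒ a constituent on which `U(𝔸)` acts trivially is NOT in `R^∧` (the infinite-dimensional ones, ★ DEF
`RHat`): on every `τ ∈ R^∧`, `U(𝔸)` acts non-trivially.
[cite: GelbartRogawski1991, §2.5 (p. 453 L22–23); §2.2 (p. 451 L19–20)] -/
theorem not_mem_rhat_of_uActsTriv (h : sec25_oneDim J) {S : Submodule ℂ (J.R → ℂ)}
    (hc : J.IsConstituent S) (ht : J.UActsTriv S) : S ∉ J.RHat := by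
  intro hS
  have h1 : Module.finrank ℂ S = 1 := h S hc ht
  exact hS.2 (Module.finite_of_finrank_eq_succ h1)

/-- Contrapositive form: `U(𝔸)` does not act trivially on any `τ ∈ R^∧` (★ `Sec2.sec25_oneDim`).
[cite: GelbartRogawski1991, §2.5 (p. 453 L22–23); §2.2 (p. 451 L19–20)] -/
theorem not_uActsTriv_of_mem_rhat (h : sec25_oneDim J) {τ : Submodule ℂ (J.R → ℂ)}
    (hτ : τ ∈ J.RHat) : ¬ J.UActsTriv τ :=
  fun ht => not_mem_rhat_of_uActsTriv J h hτ.1 ht hτ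

/-! ### Definition 2.3.1 (1)(2) ⇒ Theorem 2.4.1 (p. 452) -/

/-- **Definition 2.3.1 fed into Theorem 2.4.1**: a discrete `π` satisfying the two printed CONDITIONS
(1) «`Λ(π)` is a single `B(F)`-orbit» (★ `exc1`) and (2) «for each `φ ∈ V`, `φ_U = φ_N`» (★ `exc2`) is
exceptional (★ `Sec2.def231`) and hence «belongs to `Π(ϱ)` for some automorphic character `ϱ` of `H`»
(★ `GR91Spectrum.thm241`, `Π(ρ) = packetA η η′`).
[cite: GelbartRogawski1991, Def. 2.3.1 (p. 452 L6–9); Thm. 2.4.1 (p. 452)] -/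
theorem mem_packetA_of_conditions (hdef : def231 J) (h241 : X.thm241) (π : X.Rep)
    (hd : X.IsDiscrete π) (h1 : exc1 J π) (h2 : exc2 J π) : ∃ η η' : X.Char1, π ∈ X.packetA η η' :=
  h241 π hd ((hdef π hd).2 ⟨h1, h2⟩)

/-- Conversely (★ `Sec2.def231`): an exceptional discrete `π` satisfies CONDITIONS (1) and (2) of
Definition 2.3.1 — in particular `Λ(π) ≠ ∅`. [cite: GelbartRogawski1991, Def. 2.3.1 (p. 452 L6–9)] -/
theorem conditions_of_isExceptional (hdef : def231 J) (π : X.Rep) (hd : X.IsDiscrete π)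
    (he : X.IsExceptional π) : exc1 J π ∧ exc2 J π ∧ (J.Lambda π).Nonempty := by
  obtain ⟨h1, h2⟩ := (hdef π hd).1 he
  exact ⟨h1, h2, exc1_lambda_nonempty J π h1⟩

end Literature.NumberTheory.GelbartRogawski1991.Sec2Proofs
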